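import Summits.BirchSwinnertonDyer.BirchSwinnertonDyer.Theorems.Rank1ResidualIntModelReduction
import Summits.BirchSwinnertonDyer.Rank1Residual.X12.CMRamifiedReducible
import Literature.NumberTheory.EllipticCurves.Rank1Residual.X11RankOneCertificates.Minimality
import Literature.NumberTheory.EllipticCurves.ComplexMultiplicationLocalFactorsAux
import Literature.NumberTheory.EllipticCurves.ComplexMultiplicationTwistIsogenyProofs
import Literature.NumberTheory.EllipticCurves.OpenImageMazurFrobeniusProofs
import Literature.NumberTheory.EllipticCurves.OpenImageMazurCharacterProofs
import Literature.NumberTheory.EllipticCurves.OpenImageMazurProofs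
import Literature.NumberTheory.EllipticCurves.QuadraticTwistKroneckerLFunctionProofs
import Literature.NumberTheory.EllipticCurves.ComplexMultiplicationDeuringFrobeniusProofs
import Literature.NumberTheory.EllipticCurves.LFunctionPrimeCoeff
import Literature.NumberTheory.EllipticCurves.KrizLi2019.EisensteinHeegnerLog
import Literature.NumberTheory.GaloisRepresentations.IntegralGaloisActionProofs
import Literature.NumberTheory.Automorphic.BCDTTheoremBWildAtThreeDet
import HarnessLib

/-!
# O11 at `p = 7`, ROUTE U — (U-ss): the trace form `a_ℓ(49a1^{(D)}) ≡ χ_D(ℓ)(ℓ² + ℓ⁵) (mod 7)`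
# PROVED (no named fact), and the `hss` binder of Kriz–Li Thm. 1.20 discharged from it

HONEST FRAMING (cell `bsd-cm`, run/shared/lean/pub/bsd-cm/, verbatim): the programme isolates, for
CM elliptic curves over `ℚ` of analytic rank `≤ 1`, classes on which the FULL BSD formula is
reduced — strictly by PUBLISHED theorems entering as named-fact binders — to ONE local problem at
ONE prime, and then TYPES that residual problem. Seat `bsd-cm-ram` (generation 3), TARGET.md §2
(U-ss) / R157–R159 (planner's routes (α)/(ε)). THEOREMS ONLY — in particular the planner's
candidate named fact `gross1980_thm1312_seven` (Gross, LNM 776, Thm. 13.1.2: `A(7)[𝔭] ≅ μ₇^{⊗5}`)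
is NOT needed: the tree's Mazur-1978 toolkit proves what Route U consumes.

## What is here

* `lFunction_cm7_mod_seven` — **(E49): `a_ℓ(49a1) ≡ ℓ² + ℓ⁵ (mod 7)` for every prime `ℓ ≠ 7`**,
  PROVED: `49a1 = cm7` is reducible at `7` (`X12.not_irr_seven_of_j_eq_neg3375`, kernel isogeny
  certificate) ⇒ a `Γ_ℚ`-stable line `⟨P⟩ ⊂ E[7]` with isogeny character `r`
  (`Mazur1978.exists_isogenyCharacter`); `49a1` has good reduction at every `ℓ ≠ 7`
  (`Δ_min = −7³`), so `r` is unramified outside `7` (`Mazur1978.isogenyCharacter_eq_one_of_mem_inertia`)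
  and hence — `ℚ` has no unramified abelian extension — `r = χ̄₇ᵏ`
  (`Mazur1978.exists_forall_eq_mul_modNCyclotomicCharacter_pow` with `n = 1`); Mazur's Prop. 6.3(1)
  (`Mazur1978.isogenyCharacter_add_div_eq_frobeniusTrace`: `a_ℓ ≡ r(φ_ℓ) + ℓ·r(φ_ℓ)⁻¹`) with
  `χ̄₇(φ_ℓ) = ℓ` gives `a_ℓ ≡ ℓᵏ + ℓ^{1−k}`; at `ℓ = 2`, `a₂(49a1) = 1` (tree, kernel point count)
  forces `k ≡ 2, 5 (mod 6)`, and then `ℓᵏ + ℓ^{1−k} = ℓ² + ℓ⁵` for every `ℓ` (a finite check in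
  `(ℤ/7)ˣ`). This is Gross's `E[𝔭] ≅ μ₇^{⊗5}` / `ρ̄^{ss} = ω² ⊕ ω⁵` in trace form.
* `lFunction_twist_cm7_mod_seven` — for `W` ANY model of the twist `49a1^{(D)}` by an odd
  fundamental discriminant `D` (`D ≡ 1 (mod 4)`, squarefree, `7 ∤ D`):
  `a_ℓ(W) ≡ (ℓ/|D|)·(ℓ² + ℓ⁵) (mod 7)` for every prime `ℓ ≠ 7` (Kronecker twisting formula
  `LFunction_quadraticTwist_apply_of_emod_four_eq_one`, all `ℓ` incl. `ℓ = 2` and `ℓ ∣ D`).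
* `hss_of_traceForm` — the `hss` binder of `KrizLi2019.thm120_padicLogHeegner_unit_of_bernoulli`
  (`‖a_ℓ − (ψ(ℓ) + ψ⁻¹(ℓ)ω(ℓ))‖₇ < 1` for `ℓ ∤ 7N`) from a mod-`7` trace form
  `a_ℓ ≡ ε_ℓ(ℓ² + ℓ⁵)` and the character identity `ψ(ℓ) + ψ⁻¹(ℓ)ω(ℓ) = ε_ℓ(ω(ℓ)² + ω(ℓ)⁵)`
  (`ω` Teichmüller: `ω(ℓ) ≡ ℓ (mod 7)`); `hss_twist_cm7` — assembled for the twists of `49a1`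
  with `ε_ℓ = (ℓ/|D|)`. The remaining per-instantiation input is the DEFINITION of `ψ`
  (`ψ = χ_D·ω²` or `χ_D·ω⁵` as a `ℚ₇`-valued Dirichlet character) — character algebra, T-U4.

References: [Mazur1978] §5 (isogeny character), Prop. 6.3(1); [Gross1980] = Gross, LNM 776, §13
Thm. 13.1.2 (the statement being re-proved in trace form); [KrizLi2019] Thm. 1.20, §2 (trace
form of `E[p]^{ss}`); [SilvermanAEC2009] X.2 Exercise 10.16 (twisting).
-/

noncomputable section

open scoped Classical
open NumberField IsDedekindDomain IsDedekindDomain.HeightOneSpectrum Field WeierstrassCurve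
open Literature.NumberTheory.EllipticCurves Literature.NumberTheory.GaloisRepresentations
open Literature.NumberTheory.EllipticCurves.KrizLi2019

namespace Summit.BirchSwinnertonDyer.Rank1Residual.X12.O11.RouteU

/-! ## §1 (E49): `a_ℓ(49a1) ≡ ℓ² + ℓ⁵ (mod 7)` -/

/-- `[1, −1, 0, −2, −1]` (= `cm7`, Cremona `49a1`) is globally minimal: no prime has
`q¹² ∣ Δ = −343` (the tree's `GoldfeldGoodTwists.isGloballyMinimal_cm7`, restated on the literal
equation so that this file's import closure stays inside the O11 chain; used via `haveI`).
[cite: Cremona1997, Table 1 (curve 49a1)] -/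
theorem isGloballyMinimal_X049_eq : (⟨1, -1, 0, -2, -1⟩ : WeierstrassCurve ℚ).IsGloballyMinimal :=
  Rank1Residual.X11RankOneCertificates.isGloballyMinimal_of_int_criterion 1 (-1) 0 (-2) (-1)
    fun q hq ⟨hΔ, _⟩ => by
      have hD : Rank1Residual.X11RankOneCertificates.discOf [1, -1, 0, -2, -1] = -343 := by
        decide +kernel
      rw [hD, dvd_neg] at hΔ
      have h1 : q ^ 12 ∣ 343 := by exact_mod_cast Int.natAbs_dvd_natAbs.mpr hΔ
      have h2 : q ^ 12 ≤ 343 := Nat.le_of_dvd (by norm_num) h1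
      have h3 : 2 ^ 12 ≤ q ^ 12 := Nat.pow_le_pow_left hq.two_le 12
      omega

/-- `49a1` has good reduction at every prime `ℓ ≠ 7` (`Δ_min = −7³`).
[cite: Cremona1997, Table 1 (curve 49a1: N = 49)] -/
theorem hasGoodReductionAtPrime_cm7 (ℓ : ℕ) [hℓ : Fact ℓ.Prime] (h7 : ℓ ≠ 7) :
    cm7.HasGoodReductionAtPrime ℓ := by
  haveI : cm7.IsGloballyMinimal := isGloballyMinimal_X049_eq
  have hI : integralModelInt cm7 = ⟨1, -1, 0, -2, -1⟩ :=
    Summit.BirchSwinnertonDyer.BirchSwinnertonDyer.Rank1Residual.IntModel.integralModelInt_eq_of_map_eq _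
      (Summit.BirchSwinnertonDyer.BirchSwinnertonDyer.Rank1Residual.IntModel.map_mk_int 1 (-1) 0 (-2) (-1))
  have hmin : minimalDiscriminantInt cm7 = -343 := by
    rw [Summit.BirchSwinnertonDyer.BirchSwinnertonDyer.Rank1Residual.IntModel.minimalDiscriminantInt_eq hI]
    simp only [WeierstrassCurve.Δ, WeierstrassCurve.b₂, WeierstrassCurve.b₄, WeierstrassCurve.b₆,
      WeierstrassCurve.b₈]
    norm_num
  refine hasGoodReductionAtPrime_of_not_dvd cm7 ℓ ?_
  rw [hmin, dvd_neg, show (343 : ℤ) = 7 ^ 3 by norm_num]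
  intro h
  have h' : (ℓ : ℤ) ∣ 7 := (Nat.prime_iff_prime_int.mp hℓ.out).dvd_of_dvd_pow h
  have h'' : ℓ ∣ 7 := by exact_mod_cast h'
  exact h7 ((Nat.prime_dvd_prime_iff_eq hℓ.out (by norm_num)).mp h'')

/-- Good reduction of `49a1` at a finite place `v ∌ 7` of `ℚ`. [folklore] -/
theorem hasGoodReductionAt_cm7 {v : HeightOneSpectrum (𝓞 ℚ)} (hv : ((7 : ℕ) : 𝓞 ℚ) ∉ v.asIdeal) :
    cm7.HasGoodReductionAt v := by
  haveI := Fact.mk (Rat.HeightOneSpectrum.primesEquiv v).2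
  have h7 : (Rat.HeightOneSpectrum.primesEquiv v : ℕ) ≠ 7 := by
    intro h
    apply hv
    rw [DeuringLadic.natCast_mem_asIdeal_iff, h]
  exact (hasGoodReductionAtPrime_iff_hasGoodReductionAt_ringOfIntegers v cm7).mp
    (hasGoodReductionAtPrime_cm7 _ h7)

/-- The finite check pinning the exponent: `2ᵐ + 2·2^{5m} = 1` in `𝔽₇` with `m < 6` forces
`m ∈ {2, 5}` (`a₂(49a1) = 1`; `y⁻¹ = y⁵` in `𝔽₇ˣ`). [folklore] -/
theorem two_pow_add_eq_one_cases :
    ∀ m : ℕ, m < 6 → (2 : ZMod 7) ^ m + 2 * (2 : ZMod 7) ^ (5 * m % 6) = 1 → m = 2 ∨ m = 5 := by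
  decide

/-- In `𝔽₇`: `y⁻¹ = y⁵` for `y ≠ 0`. [folklore] -/
theorem inv_eq_pow_five_zmod7 {y : ZMod 7} (hy : y ≠ 0) : y⁻¹ = y ^ 5 := by
  haveI : Fact (Nat.Prime 7) := ⟨by norm_num⟩
  have h6 : y ^ 6 = 1 := ZMod.pow_card_sub_one_eq_one hy
  rw [inv_eq_of_mul_eq_one_right (a := y) (b := y ^ 5) (by rw [← pow_succ']; exact h6)]

/-- A prime `q ≠ 7` is a unit mod `7`: `q⁶ = 1` in `𝔽₇`. [folklore] -/
theorem natCast_pow_six_zmod7 {q : ℕ} (hq : q.Prime) (hq7 : q ≠ 7) : (q : ZMod 7) ^ 6 = 1 := by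
  haveI : Fact (Nat.Prime 7) := ⟨by norm_num⟩
  have hq0 : (q : ZMod 7) ≠ 0 := by
    rw [Ne, ZMod.natCast_eq_zero_iff]
    exact fun h => hq7 ((Nat.prime_dvd_prime_iff_eq (by norm_num) hq).mp h).symm
  exact ZMod.pow_card_sub_one_eq_one hq0

/-- **(E49)** — `a_ℓ(49a1) ≡ ℓ² + ℓ⁵ (mod 7)` for every prime `ℓ ≠ 7` (the `ℓ`-th coefficient of
`L(49a1, s)`; Gross, LNM 776 Thm. 13.1.2 / `ρ̄_{49a1,7}^{ss} = ω² ⊕ ω⁵` in trace form), PROVED from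
the tree's Mazur-1978 toolkit: `49a1` is reducible at `7` (kernel isogeny certificate), the isogeny
character of the `7`-stable line is unramified outside `7`, hence a power `χ̄₇ᵏ` of the cyclotomic
character (`ℚ` has no unramified abelian extension), `a_ℓ ≡ ℓᵏ + ℓ^{1−k}` (Prop. 6.3 (1)), and
`a₂ = 1` (kernel point count) pins `k ∈ {2, 5} (mod 6)`.
[cite: Mazur1978, §5 (p. 148) and Prop. 6.3 (1) (p. 153)] [cite: Cremona1997, Table 1 (curve 49a1)] -/
theorem lFunction_cm7_mod_seven (ℓ : ℕ) [hℓ : Fact ℓ.Prime] (h7 : ℓ ≠ 7) :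
    (cm7.LFunction ℓ : ZMod 7) = (ℓ : ZMod 7) ^ 2 + (ℓ : ZMod 7) ^ 5 := by
  haveI : Fact (Nat.Prime 7) := ⟨by norm_num⟩
  haveI : NeZero ((7 : ℕ) : ℚ) := ⟨by norm_num⟩
  haveI : cm7.IsGloballyMinimal := isGloballyMinimal_X049_eq
  -- a `Γ_ℚ`-stable line `⟨P⟩ ⊂ E[7]` and its isogeny character `r`
  have hred : ¬ cm7.HasIrreducibleModPGaloisRep 7 := X12.not_irr_seven_of_j_eq_neg3375 cm7 j_cm7
  obtain ⟨H, hH, hcard⟩ :=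
    (Mazur1978.not_hasIrreducibleModPGaloisRep_iff_exists_natCard_eq cm7 7).mp hred
  obtain ⟨P, hP0, rfl⟩ := Mazur1978.exists_eq_zmultiples_of_natCard_eq cm7 7 hcard
  have hst : ∀ σ : absoluteGaloisGroup ℚ, σ • P ∈ AddSubgroup.zmultiples P :=
    fun σ => hH σ P (AddSubgroup.mem_zmultiples P)
  obtain ⟨r, hr⟩ := Mazur1978.exists_isogenyCharacter cm7 7 hP0 hst
  -- `r` is unramified outside `7`, hence `r = χ̄₇ᵏ`
  have hker := Mazur1978.isOpen_ker_of_smul_eq cm7 7 hP0 hr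
  obtain ⟨k, -, hk⟩ := Mazur1978.exists_forall_eq_mul_modNCyclotomicCharacter_pow 7 r hker (n := 1)
    (fun v hv 𝔓 h𝔓 τ hτ => by
      rw [pow_one]
      exact Mazur1978.isogenyCharacter_eq_one_of_mem_inertia cm7 7 hP0 hr (hasGoodReductionAt_cm7 hv)
        hv h𝔓 hτ)
  have hk' : ∀ σ : absoluteGaloisGroup ℚ, r σ = modNCyclotomicCharacter ℚ 7 σ ^ k := fun σ => by
    obtain ⟨b, hb, h⟩ := hk σ
    rw [pow_one] at hb
    rw [h, hb, one_mul]
  -- Mazur's Prop. 6.3 (1) at a good prime `q ≠ 7`: `a_q ≡ qᵏ + q·q⁻ᵏ`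
  have key : ∀ (q : ℕ) [Fact q.Prime], q ≠ 7 →
      (cm7.frobeniusTrace q : ZMod 7) = (q : ZMod 7) ^ k + (q : ZMod 7) * ((q : ZMod 7) ^ k)⁻¹ := by
    intro q hq hq7
    set v : HeightOneSpectrum (𝓞 ℚ) := (Rat.HeightOneSpectrum.primesEquiv (R := 𝓞 ℚ)).symm ⟨q, hq.out⟩
      with hvdef
    have hvq : (Rat.HeightOneSpectrum.primesEquiv v : ℕ) = q := by
      rw [hvdef, Equiv.apply_symm_apply]
    have hv : (q : 𝓞 ℚ) ∈ v.asIdeal := by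
      rw [DeuringLadic.natCast_mem_asIdeal_iff, hvq]
    obtain ⟨𝔓, h𝔓⟩ := v.primesAbove_nonempty
    obtain ⟨φ, hφ⟩ := exists_isArithFrobAt_of_mem_primesAbove_holds (K := ℚ) (v := v) h𝔓
    have hq7' : ¬ q ∣ 7 := fun h => hq7 ((Nat.prime_dvd_prime_iff_eq hq.out (by norm_num)).mp h)
    have hχ : (modNCyclotomicCharacter ℚ 7 φ : ZMod 7) = q :=
      Rat.modNCyclotomicCharacter_of_isArithFrobAt hq.out hq7' hv h𝔓 hφ
    have hmaz := Mazur1978.isogenyCharacter_add_div_eq_frobeniusTrace cm7 7 q hq7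
      (hasGoodReductionAtPrime_cm7 q hq7) hP0 hr hv h𝔓 hφ
    rw [← hmaz, hk' φ, Units.val_inv_eq_inv_val, Units.val_pow_eq_pow_val, hχ]
  -- polynomial form: `a_q = q^{k mod 6} + q·q^{5k mod 6}` (`y⁻¹ = y⁵`, `q⁶ = 1`)
  have key' : ∀ (q : ℕ) [Fact q.Prime], q ≠ 7 →
      (cm7.frobeniusTrace q : ZMod 7) =
        (q : ZMod 7) ^ (k % 6) + (q : ZMod 7) * (q : ZMod 7) ^ (5 * (k % 6) % 6) := by
    intro q hq hq7
    have hq0 : (q : ZMod 7) ≠ 0 := by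
      rw [Ne, ZMod.natCast_eq_zero_iff]
      exact fun h => hq7 ((Nat.prime_dvd_prime_iff_eq (by norm_num) hq.out).mp h).symm
    have h6 := natCast_pow_six_zmod7 hq.out hq7
    have he : k * 5 % 6 = 5 * (k % 6) % 6 := by omega
    rw [key q hq7, inv_eq_pow_five_zmod7 (pow_ne_zero k hq0), ← pow_mul, pow_eq_pow_mod k h6,
      pow_eq_pow_mod (k * 5) h6, he]
  -- `a₂(49a1) = 1` (kernel point count `#Ẽ(𝔽₂) = 2`) pins `k mod 6 ∈ {2, 5}`
  have ha2 : cm7.frobeniusTrace 2 = 1 := by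
    have hI : integralModelInt cm7 = ⟨1, -1, 0, -2, -1⟩ :=
      Summit.BirchSwinnertonDyer.BirchSwinnertonDyer.Rank1Residual.IntModel.integralModelInt_eq_of_map_eq _
        (Summit.BirchSwinnertonDyer.BirchSwinnertonDyer.Rank1Residual.IntModel.map_mk_int 1 (-1) 0 (-2) (-1))
    have hcnt : Nat.card (((⟨1, -1, 0, -2, -1⟩ : WeierstrassCurve ℤ).map
        (Int.castRingHom (ZMod 2))).toAffine.Point) = 2 := by
      rw [@natCard_point_eq_one_add_card (ZMod 2) (@ZMod.instField 2 ⟨by norm_num⟩) _ _ _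
        (by decide +kernel)]
      decide +kernel
    rw [Summit.BirchSwinnertonDyer.BirchSwinnertonDyer.Rank1Residual.IntModel.frobeniusTrace_eq hI hcnt]
    norm_num
  haveI : Fact (Nat.Prime 2) := ⟨Nat.prime_two⟩
  have h₂ := key' 2 (by norm_num)
  rw [ha2] at h₂
  push_cast at h₂
  have hk6 : k % 6 = 2 ∨ k % 6 = 5 :=
    two_pow_add_eq_one_cases (k % 6) (Nat.mod_lt _ (by norm_num)) h₂.symm
  -- at `q = ℓ`
  rw [LFunction_apply_prime_eq_frobeniusTrace cm7 ℓ (hasGoodReductionAtPrime_cm7 ℓ h7), key' ℓ h7]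
  rcases hk6 with h6 | h6 <;> rw [h6] <;> ring

/-! ## §2 The twists `49a1^{(D)}`: `a_ℓ(W) ≡ (ℓ/|D|)(ℓ² + ℓ⁵) (mod 7)` -/

/-- **`a_ℓ(49a1^{(D)}) ≡ (ℓ/|D|)·(ℓ² + ℓ⁵) (mod 7)`** for every prime `ℓ ≠ 7` and ANY model `W` of
the quadratic twist of `49a1` by an odd fundamental discriminant `D` (`D ≡ 1 (mod 4)` squarefree,
`7 ∤ D`): the Kronecker twisting formula `a_n(E^{(D)}) = (n/|D|) a_n(E)` (tree,
`LFunction_quadraticTwist_apply_of_emod_four_eq_one` — valid at ALL `n`, incl. `ℓ = 2` and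
`ℓ ∣ D`), `LFunction_smul`, `a_ℓ = frobeniusTrace` at the good prime `ℓ` of `49a1`, and (E49).
[cite: SilvermanAEC2009, X.2 and Exercise 10.16] [cite: Mazur1978, Prop. 6.3 (1) (p. 153)] -/
theorem lFunction_twist_cm7_mod_seven (W : WeierstrassCurve ℚ) [W.IsElliptic] {D : ℤ}
    (hD4 : D % 4 = 1) (hsq : Squarefree D) (h7D : ¬ (7 : ℤ) ∣ D)
    (hW : ∃ C : VariableChange ℚ, C • W = cm7.quadraticTwist (D : ℚ))
    (ℓ : ℕ) [hℓ : Fact ℓ.Prime] (h7 : ℓ ≠ 7) :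
    ((W.LFunction ℓ : ℤ) : ZMod 7) =
      (jacobiSym (ℓ : ℤ) D.natAbs : ZMod 7) * ((ℓ : ZMod 7) ^ 2 + (ℓ : ZMod 7) ^ 5) := by
  obtain ⟨C, hC⟩ := hW
  have hgood : ∀ v : HeightOneSpectrum (𝓞 ℚ), ((Rat.HeightOneSpectrum.primesEquiv v : ℕ) : ℤ) ∣ D →
      cm7.HasGoodReductionAt v := by
    intro v hvD
    refine hasGoodReductionAt_cm7 fun h7v => h7D ?_
    have h := (DeuringLadic.natCast_mem_asIdeal_iff v 7).mp h7v
    have h7eq : (Rat.HeightOneSpectrum.primesEquiv v : ℕ) = 7 :=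
      ((Nat.prime_dvd_prime_iff_eq (Rat.HeightOneSpectrum.primesEquiv v).2 (by norm_num)).mp h)
    rwa [h7eq] at hvD
  have h1 : W.LFunction ℓ = (cm7.quadraticTwist (D : ℚ)).LFunction ℓ := by
    rw [← hC, LFunction_smul]
  rw [h1, LFunction_quadraticTwist_apply_of_emod_four_eq_one cm7 hD4 hsq hgood ℓ]
  push_cast
  rw [lFunction_cm7_mod_seven ℓ h7]

/-! ## §3 The `hss` binder of Kriz–Li Thm. 1.20 from a mod-`7` trace form -/

/-- In `ℚ_p`: if `‖x − a‖ < 1` for an integer `a` then `‖x‖ ≤ 1`. [folklore] -/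
theorem norm_le_one_of_norm_sub_intCast_lt_one {p : ℕ} [Fact p.Prime] {x : ℚ_[p]} {a : ℤ}
    (h : ‖x - (a : ℚ_[p])‖ < 1) : ‖x‖ ≤ 1 := by
  have : x = (x - a) + a := by ring
  rw [this]
  exact (Padic.nonarchimedean _ _).trans (max_le h.le (Padic.norm_int_le_one a))

/-- In `ℚ_p`: `‖x − y‖ < 1` with `x, y` integral ⇒ `‖xʲ − yʲ‖ < 1` (`x − y ∣ xʲ − yʲ` in `ℤ_p`).
[folklore] -/
theorem norm_pow_sub_pow_lt_one {p : ℕ} [Fact p.Prime] {x y : ℚ_[p]} (hx : ‖x‖ ≤ 1) (hy : ‖y‖ ≤ 1)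
    (h : ‖x - y‖ < 1) (j : ℕ) : ‖x ^ j - y ^ j‖ < 1 := by
  set X : ℤ_[p] := ⟨x, hx⟩
  set Y : ℤ_[p] := ⟨y, hy⟩
  obtain ⟨q, hq⟩ := sub_dvd_pow_sub_pow X Y j
  have hXY : ‖X - Y‖ < 1 := by rw [PadicInt.norm_def, PadicInt.coe_sub]; exact h
  have : x ^ j - y ^ j = ((X ^ j - Y ^ j : ℤ_[p]) : ℚ_[p]) := by
    rw [PadicInt.coe_sub, PadicInt.coe_pow, PadicInt.coe_pow]
  rw [this, ← PadicInt.norm_def, hq, norm_mul]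
  calc ‖X - Y‖ * ‖q‖ ≤ ‖X - Y‖ * 1 :=
        mul_le_mul_of_nonneg_left (PadicInt.norm_le_one q) (norm_nonneg _)
    _ < 1 := by rw [mul_one]; exact hXY

/-- **`hss` from a trace form.** Let `p = 7`, `W/ℚ`, `ω` a Teichmüller character mod `7`
(`‖ω(a) − a‖₇ < 1`), `ψ` any Dirichlet character with values in `ℚ₇`. If for every prime
`ℓ ∤ 7N` there is an integer `ε_ℓ` with (a) `a_ℓ(W) ≡ ε_ℓ(ℓ² + ℓ⁵) (mod 7)` and (b)
`ψ(ℓ) + ψ⁻¹(ℓ)ω(ℓ) = ε_ℓ·(ω(ℓ)² + ω(ℓ)⁵)`, then the trace-form hypothesis of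
`KrizLi2019.thm120_padicLogHeegner_unit_of_bernoulli` holds:
`‖a_ℓ − (ψ(ℓ) + ψ⁻¹(ℓ)ω(ℓ))‖₇ < 1` for all primes `ℓ ∤ 7N`. [cite: KrizLi2019, Thm. 1.20 and §2 (trace form of E[p]^{ss})] -/
theorem hss_of_traceForm (W : WeierstrassCurve ℚ) {f : ℕ} (ψ : DirichletCharacter ℚ_[7] f)
    (ω : DirichletCharacter ℚ_[7] 7) (hω : IsTeichmullerCharacter ω) (ε : ℕ → ℤ)
    (ha : ∀ ℓ : ℕ, ℓ.Prime → ¬ (ℓ ∣ 7 * W.conductorNorm ℤ) →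
      ((W.LFunction ℓ : ℤ) : ZMod 7) = (ε ℓ : ZMod 7) * ((ℓ : ZMod 7) ^ 2 + (ℓ : ZMod 7) ^ 5))
    (hψ : ∀ ℓ : ℕ, ℓ.Prime → ¬ (ℓ ∣ 7 * W.conductorNorm ℤ) →
      ψ (ℓ : ZMod f) + ψ⁻¹ (ℓ : ZMod f) * ω (ℓ : ZMod 7) =
        (ε ℓ : ℚ_[7]) * (ω (ℓ : ZMod 7) ^ 2 + ω (ℓ : ZMod 7) ^ 5)) :
    ∀ ℓ : ℕ, ℓ.Prime → ¬ (ℓ ∣ 7 * W.conductorNorm ℤ) →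
      ‖((W.LFunction ℓ : ℤ) : ℚ_[7]) -
        (ψ (ℓ : ZMod f) + ψ⁻¹ (ℓ : ZMod f) * ω (ℓ : ZMod 7))‖ < 1 := by
  intro ℓ hℓ hℓN
  have hℓ7 : ¬ ((7 : ℤ) ∣ (ℓ : ℤ)) := by
    intro h
    have h' : 7 ∣ ℓ := by exact_mod_cast h
    have h77 : ℓ = 7 := ((Nat.prime_dvd_prime_iff_eq (by norm_num) hℓ).mp h').symm
    rw [h77] at hℓN
    exact hℓN (dvd_mul_right 7 _)
  rw [hψ ℓ hℓ hℓN]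
  -- `ω(ℓ) ≡ ℓ`, hence `ω(ℓ)² + ω(ℓ)⁵ ≡ ℓ² + ℓ⁵ (mod 7ℤ₇)`
  have hωℓ : ‖ω (ℓ : ZMod 7) - (ℓ : ℚ_[7])‖ < 1 := by
    have := hω (ℓ : ℤ) hℓ7
    push_cast at this
    exact this
  have hω1 : ‖ω (ℓ : ZMod 7)‖ ≤ 1 := norm_le_one_of_norm_sub_intCast_lt_one (a := ℓ) (by push_cast; exact hωℓ)
  have hℓ1 : ‖(ℓ : ℚ_[7])‖ ≤ 1 := by exact_mod_cast Padic.norm_int_le_one (ℓ : ℤ)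
  have hS : ‖(ω (ℓ : ZMod 7) ^ 2 + ω (ℓ : ZMod 7) ^ 5) - ((ℓ : ℚ_[7]) ^ 2 + (ℓ : ℚ_[7]) ^ 5)‖ < 1 := by
    have e : (ω (ℓ : ZMod 7) ^ 2 + ω (ℓ : ZMod 7) ^ 5) - ((ℓ : ℚ_[7]) ^ 2 + (ℓ : ℚ_[7]) ^ 5) =
        (ω (ℓ : ZMod 7) ^ 2 - (ℓ : ℚ_[7]) ^ 2) + (ω (ℓ : ZMod 7) ^ 5 - (ℓ : ℚ_[7]) ^ 5) := by ring
    rw [e]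
    exact (Padic.nonarchimedean _ _).trans_lt
      (max_lt (norm_pow_sub_pow_lt_one hω1 hℓ1 hωℓ 2) (norm_pow_sub_pow_lt_one hω1 hℓ1 hωℓ 5))
  -- `a_ℓ ≡ ε_ℓ(ℓ² + ℓ⁵) (mod 7)` as an integer congruence
  have hA : ‖((W.LFunction ℓ : ℤ) : ℚ_[7]) - (ε ℓ : ℚ_[7]) * ((ℓ : ℚ_[7]) ^ 2 + (ℓ : ℚ_[7]) ^ 5)‖ < 1 := by
    have h0 : ((W.LFunction ℓ - ε ℓ * ((ℓ : ℤ) ^ 2 + (ℓ : ℤ) ^ 5) : ℤ) : ZMod 7) = 0 := by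
      push_cast
      rw [ha ℓ hℓ hℓN, sub_self]
    have hdvd : ((7 : ℕ) : ℤ) ∣ W.LFunction ℓ - ε ℓ * ((ℓ : ℤ) ^ 2 + (ℓ : ℤ) ^ 5) :=
      (ZMod.intCast_zmod_eq_zero_iff_dvd _ 7).mp h0
    have := (Padic.norm_intCast_lt_one_iff (p := 7)).mpr hdvd
    push_cast at this
    exact this
  -- `ε_ℓ·(ω² + ω⁵) ≡ ε_ℓ·(ℓ² + ℓ⁵)`
  have hB : ‖(ε ℓ : ℚ_[7]) * ((ℓ : ℚ_[7]) ^ 2 + (ℓ : ℚ_[7]) ^ 5) -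
      (ε ℓ : ℚ_[7]) * (ω (ℓ : ZMod 7) ^ 2 + ω (ℓ : ZMod 7) ^ 5)‖ < 1 := by
    rw [← mul_sub, norm_mul, norm_sub_rev]
    calc ‖(ε ℓ : ℚ_[7])‖ * ‖(ω (ℓ : ZMod 7) ^ 2 + ω (ℓ : ZMod 7) ^ 5) - ((ℓ : ℚ_[7]) ^ 2 + (ℓ : ℚ_[7]) ^ 5)‖
        ≤ 1 * ‖(ω (ℓ : ZMod 7) ^ 2 + ω (ℓ : ZMod 7) ^ 5) - ((ℓ : ℚ_[7]) ^ 2 + (ℓ : ℚ_[7]) ^ 5)‖ :=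
          mul_le_mul_of_nonneg_right (Padic.norm_int_le_one _) (norm_nonneg _)
      _ < 1 := by rw [one_mul]; exact hS
  have e : ((W.LFunction ℓ : ℤ) : ℚ_[7]) - (ε ℓ : ℚ_[7]) * (ω (ℓ : ZMod 7) ^ 2 + ω (ℓ : ZMod 7) ^ 5) =
      (((W.LFunction ℓ : ℤ) : ℚ_[7]) - (ε ℓ : ℚ_[7]) * ((ℓ : ℚ_[7]) ^ 2 + (ℓ : ℚ_[7]) ^ 5)) +
      ((ε ℓ : ℚ_[7]) * ((ℓ : ℚ_[7]) ^ 2 + (ℓ : ℚ_[7]) ^ 5) -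
        (ε ℓ : ℚ_[7]) * (ω (ℓ : ZMod 7) ^ 2 + ω (ℓ : ZMod 7) ^ 5)) := by ring
  rw [e]
  exact (Padic.nonarchimedean _ _).trans_lt (max_lt hA hB)

/-- **(U-ss) for ROUTE U, assembled**: for ANY model `W` of `49a1^{(D)}` (`D ≡ 1 (mod 4)`
squarefree, `7 ∤ D`), a Teichmüller character `ω` mod `7` and a `ℚ₇`-valued Dirichlet character
`ψ` with `ψ(ℓ) + ψ⁻¹(ℓ)ω(ℓ) = (ℓ/|D|)·(ω(ℓ)² + ω(ℓ)⁵)` at the primes `ℓ ∤ 7N_W` (e.g. `ψ = χ_D ω²`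
or `χ_D ω⁵`): the `hss` binder of `KrizLi2019.thm120_padicLogHeegner_unit_of_bernoulli` /
`RouteU.bsdp_of_thm120_of_rem310` holds. [cite: KrizLi2019, Thm. 1.20, Rem. 1.21 and §2]
[cite: Mazur1978, Prop. 6.3 (1) (p. 153)] -/
theorem hss_twist_cm7 (W : WeierstrassCurve ℚ) [W.IsElliptic] {D : ℤ}
    (hD4 : D % 4 = 1) (hsq : Squarefree D) (h7D : ¬ (7 : ℤ) ∣ D)
    (hW : ∃ C : VariableChange ℚ, C • W = cm7.quadraticTwist (D : ℚ))
    {f : ℕ} (ψ : DirichletCharacter ℚ_[7] f) (ω : DirichletCharacter ℚ_[7] 7)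
    (hω : IsTeichmullerCharacter ω)
    (hψ : ∀ ℓ : ℕ, ℓ.Prime → ¬ (ℓ ∣ 7 * W.conductorNorm ℤ) →
      ψ (ℓ : ZMod f) + ψ⁻¹ (ℓ : ZMod f) * ω (ℓ : ZMod 7) =
        (jacobiSym (ℓ : ℤ) D.natAbs : ℚ_[7]) * (ω (ℓ : ZMod 7) ^ 2 + ω (ℓ : ZMod 7) ^ 5)) :
    ∀ ℓ : ℕ, ℓ.Prime → ¬ (ℓ ∣ 7 * W.conductorNorm ℤ) →
      ‖((W.LFunction ℓ : ℤ) : ℚ_[7]) -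
        (ψ (ℓ : ZMod f) + ψ⁻¹ (ℓ : ZMod f) * ω (ℓ : ZMod 7))‖ < 1 := by
  refine hss_of_traceForm W ψ ω hω (fun ℓ => jacobiSym (ℓ : ℤ) D.natAbs) (fun ℓ hℓ hℓN => ?_) hψ
  haveI : Fact ℓ.Prime := ⟨hℓ⟩
  have h7 : ℓ ≠ 7 := by rintro rfl; exact hℓN (dvd_mul_right 7 _)
  exact lFunction_twist_cm7_mod_seven W hD4 hsq h7D hW ℓ h7

end Summit.BirchSwinnertonDyer.Rank1Residual.X12.O11.RouteU

end
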